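import Summits.ResolutionOfSingularities.ResolutionOfSingularities.Theorems.WeightedInvariantGradedChartBasicOpen
import Summits.ResolutionOfSingularities.ResolutionOfSingularities.Theorems.WeightedInvariantELadderTwoGenSingNonempty
import Summits.ResolutionOfSingularities.ResolutionOfSingularities.Theorems.WeightedInvariantGradedHomogeneousHeight
import Literature.AlgebraicGeometry.Resolution.DerivativeIdealSheaf
import Literature.AlgebraicGeometry.Resolution.MarkedIdeals
import Literature.AlgebraicGeometry.Motives.CyclesDimensionProofs
import HarnessLib

/-!
# Graded chart reading, III (stage level): the torus-stable affine neighbourhood `D(t)` of an orbit-generic point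

Cell `res-hironaka`, line `L W4.3`, door crux `HypersurfaceCentreConstruction` (stmt-ResolutionOfSingularities-19897),
E2 tier; residual (γ) of ORDER (o47-a) (res-D-pv-031), third «graded chart reading» file (shared with (C-b)/(S-c)).
OURS bookkeeping; nothing here is a statement of [Hironaka2017]; AI-written, weaker than expert review.

For a stage `S`, a unit chart `W a` and a point `η ∈ W a ∩ i(X)` whose prime `𝔭_a(η)` is homogeneous:

* `Stage.kStr S : k →+* Γ(Y, ⊤)` — the `k`-structure of the ambient `Y`; `smooth_sections`, `finiteType_sections`,
  `isNoetherianRing_sections`; `algebraMap_mem_piece_zero` — constants have degree `0` on every chart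
  (`GradedAtlas.appLE_mem`), and so on every `D(t) ⊆ W a` (`algebraMap_mem_awayGrading_zero`);
* `Stage.exists_readSection` — **the section `t`**: homogeneous, `t ∉ 𝔭_a(η)`, divisible by a homogeneous unit
  section of every basis degree `e·eᵢ` (unit chart), by the component-discarding `g` of
  `GradedChart.exists_isHomogeneousElem_not_mem_forall_mem_minimalPrimes`, and by the homogeneous denominator
  `g'` of a HOMOGENEOUS LOCAL GENERATOR `F` of `𝓘(X)(W a)` at `η`
  (`GradedChart.exists_isHomogeneousElem_map_eq_span` on the stalk, `…_not_mem_smul_le`);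
* `Stage.ringKrullDim_quotient_le_of_le_primeIdealOf` — **under (I0)₂, `dim Γ(Y, W a) ⧸ Q ≤ j + 3` for every prime
  `Q ≤ 𝔭_a(η)` when `η = i x ∈ singImage`** (Hartshorne I.1.8A `Ideal.height_add_ringKrullDim_quotient`:
  `ht(𝔭/Q) + dim A/𝔭 ≤ dim 𝒪_{Y,η} + dim closure η = (coheight x + 1) + height x = j + 3`; no component theory).

The next file reads `ι` on `D(t)` and proves the attainment of `mu₂`.
-/

noncomputable section

set_option linter.dupNamespace false -- mandated namespace of this single-conjunct summit

open CategoryTheory AlgebraicGeometry TopologicalSpace IsLocalRing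
open Literature.AlgebraicGeometry.Resolution
open Summit.ResolutionOfSingularities.ResolutionOfSingularities.Theorems
open Summit.ResolutionOfSingularities.ResolutionOfSingularities.Theorems.GradedChart
open Summit.ResolutionOfSingularities.ResolutionOfSingularities.Cruxes.HypersurfaceCentreConstruction.LocalEngine

namespace Summit.ResolutionOfSingularities.ResolutionOfSingularities.Theorems.ELadderOne.Stage

variable {k : Type} [Field k] (S : Stage k)

/-! ## The `k`-structure of the ambient scheme and its affine pieces -/

/-- The `k`-structure `k ≅ Γ(Spec k, 𝒪) → Γ(Y, 𝒪_Y)` of the stage. [folklore] -/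
def kStr : k →+* Γ(S.Y, ⊤) := S.f.appTop.hom.comp (Scheme.ΓSpecIso (.of k)).inv.hom

/-- **`Γ(Y, U)` is a smooth `k`-algebra** for every affine open `U` (`Y → Spec k` is smooth; smoothness is
affine-local, Mathlib `HasRingHomProperty`). [folklore] -/
theorem smooth_sections (U : S.Y.affineOpens) :
    letI := sectionsAlgebra S.kStr U
    Algebra.Smooth k Γ(S.Y, U) := by
  have h := HasRingHomProperty.appLE (P := @Smooth) (f := S.f) inferInstance ⟨⊤, isAffineOpen_top _⟩ U le_top
  have h' := (RingHom.Smooth.respectsIso.cancel_left_isIso (Scheme.ΓSpecIso (.of k)).inv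
    (S.f.appLE ⊤ U le_top)).mpr h
  exact h'.toAlgebra

/-- `Γ(Y, U)` is a finite-type `k`-algebra for every affine open `U`. [folklore] -/
theorem finiteType_sections (U : S.Y.affineOpens) :
    letI := sectionsAlgebra S.kStr U
    Algebra.FiniteType k Γ(S.Y, U) := by
  have h := HasRingHomProperty.appLE (P := @LocallyOfFiniteType) (f := S.f) inferInstance
    ⟨⊤, isAffineOpen_top _⟩ U le_top
  have h' := (RingHom.finiteType_respectsIso.cancel_left_isIso (Scheme.ΓSpecIso (.of k)).inv
    (S.f.appLE ⊤ U le_top)).mpr h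
  exact h'

/-- `Γ(Y, U)` is Noetherian for every affine open `U`. [folklore] -/
theorem isNoetherianRing_sections (U : S.Y.affineOpens) : IsNoetherianRing Γ(S.Y, U) :=
  haveI : IsLocallyNoetherian S.Y := LocallyOfFiniteType.isLocallyNoetherian S.f
  IsLocallyNoetherian.component_noetherian U

/-- **Constants have degree `0`** on every chart of the atlas (`GradedAtlas.appLE_mem`). [folklore] -/
theorem algebraMap_mem_piece_zero (a : S.atlas.ι) (c : k) :
    letI := sectionsAlgebra S.kStr (S.atlas.W a)
    algebraMap k Γ(S.Y, S.atlas.W a) c ∈ S.atlas.piece a 0 := by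
  have h := S.atlas.appLE_mem a ((Scheme.ΓSpecIso (.of k)).inv c)
  exact h

/-- … hence degree `0` for the induced grading of every torus-stable basic open `D(t) ⊆ W a`. [folklore] -/
theorem algebraMap_mem_awayGrading_zero (a : S.atlas.ι) {δ : Fin S.j → ℤ} {t : Γ(S.Y, S.atlas.W a)}
    (ht : t ∈ S.atlas.piece a δ) (c : k) :
    letI := S.atlas.gradedRing a
    letI := sectionsAlgebra S.kStr (S.Y.basicOpen t)
    algebraMap k Γ(S.Y, S.Y.basicOpen t) c ∈ awayGrading (S.atlas.W a) (S.atlas.piece a) ht 0 := by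
  letI := S.atlas.gradedRing a
  have h := algebraMap_mem_awayGrading (S.atlas.W a) (S.atlas.piece a) ht (S.algebraMap_mem_piece_zero a c)
  have e : algebraMap Γ(S.Y, S.atlas.W a) Γ(S.Y, S.Y.basicOpen t)
      (letI := sectionsAlgebra S.kStr (S.atlas.W a); algebraMap k Γ(S.Y, S.atlas.W a) c) =
      (letI := sectionsAlgebra S.kStr (S.Y.basicOpen t); algebraMap k Γ(S.Y, S.Y.basicOpen t) c) := by
    change ((S.Y.presheaf.map (homOfLE (S.Y.basicOpen_le t)).op).hom.comp (sectionsHom S.kStr (S.atlas.W a))) c =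
      sectionsHom S.kStr (S.Y.basicOpen t) c
    rw [map_comp_sectionsHom]
  rw [← e]
  exact h

/-! ## The section `t` at a point with homogeneous prime -/

/-- **Unit sections lie outside the prime of every point of the hypersurface on the chart.** [folklore] -/
theorem not_mem_primeIdealOf_of_isUnit_app (a : S.atlas.ι) {η : S.Y} (hηa : η ∈ (S.atlas.W a : S.Y.Opens))
    (hηX : η ∈ Set.range S.i.base) {s : Γ(S.Y, S.atlas.W a)} (hs : IsUnit (S.i.app (S.atlas.W a) s)) :
    s ∉ ((S.atlas.W a).2.primeIdealOf ⟨η, hηa⟩).asIdeal := by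
  intro hsP
  have hu := S.isUnit_quotient_primeIdealOf_of_isUnit_app a hηa hηX hs
  rw [Ideal.Quotient.eq_zero_iff_mem.mpr hsP, isUnit_zero_iff] at hu
  exact ((S.atlas.W a).2.primeIdealOf ⟨η, hηa⟩).2.ne_top (Ideal.Quotient.zero_eq_one_iff.mp hu)

/-- **A homogeneous local generator of `𝓘(X)(W a)` at a point of the chart** (`X` is locally principal; the stalk
ideal is the extension of `𝓘(X)(W a)` along the germ map into the local ring `𝒪_{Y,η}`;
`GradedChart.exists_isHomogeneousElem_map_eq_span`), with a homogeneous denominator off the prime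
(`GradedChart.exists_isHomogeneousElem_not_mem_smul_le`). [folklore] -/
theorem exists_homogeneous_localGenerator (a : S.atlas.ι) {η : S.Y} (hηa : η ∈ (S.atlas.W a : S.Y.Opens)) :
    letI := S.atlas.gradedRing a
    ∃ F g' : Γ(S.Y, S.atlas.W a), SetLike.IsHomogeneousElem (S.atlas.piece a) F ∧ F ∈ S.i.ker.ideal (S.atlas.W a) ∧
      SetLike.IsHomogeneousElem (S.atlas.piece a) g' ∧ g' ∉ ((S.atlas.W a).2.primeIdealOf ⟨η, hηa⟩).asIdeal ∧
      ∀ x ∈ S.i.ker.ideal (S.atlas.W a), g' * x ∈ Ideal.span {F} := by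
  letI := S.atlas.gradedRing a
  haveI := S.isNoetherianRing_sections (S.atlas.W a)
  set P := ((S.atlas.W a).2.primeIdealOf ⟨η, hηa⟩).asIdeal with hP
  haveI : P.IsPrime := ((S.atlas.W a).2.primeIdealOf ⟨η, hηa⟩).2
  -- the stalk `𝒪_{Y,η}` is the localisation at `P`, and `𝓘(X)_η` is principal there
  letI := S.Y.presheaf.algebra_section_stalk (⟨η, hηa⟩ : (S.atlas.W a : S.Y.Opens))
  haveI hloc : IsLocalization.AtPrime (S.Y.presheaf.stalk η) P := (S.atlas.W a).2.isLocalization_stalk ⟨η, hηa⟩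
  have hprinc : stalkIdeal S.i.ker η = Ideal.span {localGenerator S.i.ker η} :=
    stalkIdeal_eq_span_localGenerator S.i.ker η (S.isLocallyPrincipal η).isPrincipal_stalkIdeal.principal
  have hmapL : (S.i.ker.ideal (S.atlas.W a)).map (algebraMap Γ(S.Y, S.atlas.W a) (S.Y.presheaf.stalk η)) =
      Ideal.span {localGenerator S.i.ker η} := by
    rw [← hprinc, stalkIdeal_eq_map_germ S.i.ker (S.atlas.W a) hηa]
    rfl
  obtain ⟨F, hFI, hFh, hFmap⟩ := exists_isHomogeneousElem_map_eq_span (S.atlas.piece a)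
    (S.atlas.isHomogeneous_ker a) hmapL
  -- transfer to `Localization.AtPrime P`
  let e : S.Y.presheaf.stalk η ≃ₐ[Γ(S.Y, S.atlas.W a)] Localization.AtPrime P :=
    IsLocalization.algEquiv P.primeCompl (S.Y.presheaf.stalk η) (Localization.AtPrime P)
  have hFmap' : (S.i.ker.ideal (S.atlas.W a)).map (algebraMap Γ(S.Y, S.atlas.W a) (Localization.AtPrime P)) =
      Ideal.span {algebraMap Γ(S.Y, S.atlas.W a) (Localization.AtPrime P) F} := by
    have hcomp : algebraMap Γ(S.Y, S.atlas.W a) (Localization.AtPrime P) =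
        (e : S.Y.presheaf.stalk η →+* Localization.AtPrime P).comp
          (algebraMap Γ(S.Y, S.atlas.W a) (S.Y.presheaf.stalk η)) := by
      ext x
      exact (e.commutes x).symm
    rw [hcomp, ← Ideal.map_map, hFmap, Ideal.map_span, Set.image_singleton, RingHom.comp_apply]
  obtain ⟨g', hg'h, hg'P, hg'⟩ := exists_isHomogeneousElem_not_mem_smul_le (S.atlas.piece a)
    (S.atlas.isHomogeneous_ker a) P hFh hFmap'
  exact ⟨F, g', hFh, hFI, hg'h, hg'P, hg'⟩

/-- **The section `t` of the read chart at a point with HOMOGENEOUS prime on a UNIT chart.**  There are a homogeneous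
section `t ∉ 𝔭_a(η)` and a homogeneous `F ∈ 𝓘(X)(W a)` such that: every basis degree `e·eᵢ` has a homogeneous
unit section dividing `t`; some `g ∣ t` lies in every minimal prime of `Γ(Y, W a)` not contained in `𝔭_a(η)`; some
`g' ∣ t` multiplies `𝓘(X)(W a)` into `(F)`. [folklore] -/
theorem exists_readSection (a : S.atlas.ι) (ha : S.IsUnitChart a) {η : S.Y} (hηa : η ∈ (S.atlas.W a : S.Y.Opens))
    (hηX : η ∈ Set.range S.i.base) :
    letI := S.atlas.gradedRing a
    ∃ (δ : Fin S.j → ℤ) (t F : Γ(S.Y, S.atlas.W a)), t ∈ S.atlas.piece a δ ∧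
      t ∉ ((S.atlas.W a).2.primeIdealOf ⟨η, hηa⟩).asIdeal ∧
      SetLike.IsHomogeneousElem (S.atlas.piece a) F ∧ F ∈ S.i.ker.ideal (S.atlas.W a) ∧
      (∀ i : Fin S.j, ∃ s ∈ S.atlas.piece a (Pi.single i (S.atlas.exponent : ℤ)), s ∣ t) ∧
      (∃ g : Γ(S.Y, S.atlas.W a), g ∣ t ∧
        ∀ Q ∈ minimalPrimes Γ(S.Y, S.atlas.W a), g ∉ Q → Q ≤ ((S.atlas.W a).2.primeIdealOf ⟨η, hηa⟩).asIdeal) ∧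
      (∃ g' : Γ(S.Y, S.atlas.W a), g' ∣ t ∧ ∀ x ∈ S.i.ker.ideal (S.atlas.W a), g' * x ∈ Ideal.span {F}) := by
  letI := S.atlas.gradedRing a
  haveI := S.isNoetherianRing_sections (S.atlas.W a)
  set P := ((S.atlas.W a).2.primeIdealOf ⟨η, hηa⟩).asIdeal with hP
  haveI hPp : P.IsPrime := ((S.atlas.W a).2.primeIdealOf ⟨η, hηa⟩).2
  -- unit sections of the basis degrees
  have hunit : ∀ i : Fin S.j, ∃ s ∈ S.atlas.piece a (Pi.single i (S.atlas.exponent : ℤ)), s ∉ P := by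
    intro i
    obtain ⟨s, hs, hu⟩ := ha (Pi.single i 1)
    refine ⟨s, ?_, S.not_mem_primeIdealOf_of_isUnit_app a hηa hηX hu⟩
    have e : S.atlas.exponent • (Pi.single i (1 : ℤ) : Fin S.j → ℤ) = Pi.single i (S.atlas.exponent : ℤ) := by
      ext i'
      by_cases hi : i' = i
      · subst hi; simp
      · simp [hi]
    rw [← e]
    exact hs
  choose s hs hsP using hunit
  -- the component-discarding element and the homogeneous local generator
  obtain ⟨g, ⟨dg, hg⟩, hgP, hgmin⟩ :=
    exists_isHomogeneousElem_not_mem_forall_mem_minimalPrimes (S.atlas.piece a) (P := P)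
  obtain ⟨F, g', hFh, hFI, ⟨dg', hg'⟩, hg'P, hg'F⟩ := S.exists_homogeneous_localGenerator a hηa
  -- `t := (∏ sᵢ) · g · g'`
  refine ⟨∑ i, Pi.single i (S.atlas.exponent : ℤ) + dg + dg', (∏ i, s i) * g * g', F, ?_, ?_, hFh, hFI,
    fun i => ⟨s i, hs i, ?_⟩, ⟨g, ⟨(∏ i, s i) * g', by ring⟩, fun Q hQ hgQ => ?_⟩, ⟨g', ⟨(∏ i, s i) * g, by ring⟩, hg'F⟩⟩
  · exact SetLike.mul_mem_graded (SetLike.mul_mem_graded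
      (SetLike.prod_mem_graded (S.atlas.piece a) (fun i => Pi.single i (S.atlas.exponent : ℤ)) (fun i => s i)
        (F := Finset.univ) (fun i _ => hs i)) hg) hg'
  · intro ht
    rcases hPp.mem_or_mem ht with h1 | h1
    · rcases hPp.mem_or_mem h1 with h2 | h2
      · obtain ⟨i, -, hi⟩ := hPp.prod_mem_iff.mp h2
        exact hsP i hi
      · exact hgP h2
    · exact hg'P h1
  · exact dvd_mul_of_dvd_left (dvd_mul_of_dvd_left (Finset.dvd_prod_of_mem s (Finset.mem_univ i)) g) g'
  · by_contra hQP
    exact hgQ (hgmin Q hQ hQP)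

/-! ## Dimension of the read chart -/

/-- **Krull dimension of a localisation through its surviving minimal primes.**  If `g ∣ t` and every minimal prime
`Q` of `A` avoiding `g` has `dim A ⧸ Q ≤ n`, then `dim A_t ≤ n`: a prime `𝔮` of `A_t` contracts to a prime `P ∌ g`
of `A`, above a minimal prime `Q ∌ g`, and `coheight 𝔮 ≤ coheight P ≤ coheight Q = dim A ⧸ Q`. [folklore] -/
theorem _root_.Summit.ResolutionOfSingularities.ResolutionOfSingularities.Theorems.GradedChart.ringKrullDim_le_of_minimalPrimes
    {A L : Type*} [CommRing A] [CommRing L] [Algebra A L] {t g : A} (hgt : g ∣ t) [IsLocalization.Away t L]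
    {n : ℕ} (h : ∀ Q ∈ minimalPrimes A, g ∉ Q → ringKrullDim (A ⧸ Q) ≤ n) : ringKrullDim L ≤ n := by
  rw [ringKrullDim, Order.krullDim_eq_iSup_coheight]
  refine iSup_le fun 𝔮 => ?_
  have hmono : Monotone (PrimeSpectrum.comap (algebraMap A L)) := fun p q hpq => Ideal.comap_mono hpq
  have hf : StrictMono (PrimeSpectrum.comap (algebraMap A L)) :=
    hmono.strictMono_of_injective (PrimeSpectrum.localization_comap_injective L (Submonoid.powers t))
  set P₀ : PrimeSpectrum A := PrimeSpectrum.comap (algebraMap A L) 𝔮 with hP₀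
  have h1 : Order.coheight 𝔮 ≤ Order.coheight P₀ := Order.coheight_le_coheight_apply_of_strictMono _ hf 𝔮
  -- `t ∉ P₀`, hence `g ∉ P₀`
  have htP : t ∉ P₀.asIdeal := by
    intro htP
    have hu : IsUnit (algebraMap A L t) := IsLocalization.Away.algebraMap_isUnit t
    exact 𝔮.2.ne_top (Ideal.eq_top_of_isUnit_mem _ (by exact htP) hu)
  obtain ⟨Q, hQmin, hQP⟩ := Ideal.exists_minimalPrimes_le (bot_le : (⊥ : Ideal A) ≤ P₀.asIdeal)
  have hgQ : g ∉ Q := fun hgQ => htP (Ideal.mem_of_dvd _ hgt (hQP hgQ))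
  haveI : Q.IsPrime := hQmin.1.1
  have h2 : Order.coheight P₀ ≤ Order.coheight (⟨Q, hQmin.1.1⟩ : PrimeSpectrum A) :=
    Order.coheight_anti (show (⟨Q, hQmin.1.1⟩ : PrimeSpectrum A) ≤ P₀ from hQP)
  have h3 := Literature.AlgebraicGeometry.Dimension.PrimeSpectrum.coe_coheight_eq_ringKrullDim_quotient
    (⟨Q, hQmin.1.1⟩ : PrimeSpectrum A)
  calc ((Order.coheight 𝔮 : ℕ∞) : WithBot ℕ∞) ≤ Order.coheight P₀ := by exact_mod_cast h1
    _ ≤ Order.coheight (⟨Q, hQmin.1.1⟩ : PrimeSpectrum A) := by exact_mod_cast h2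
    _ = ringKrullDim (A ⧸ Q) := h3
    _ ≤ n := h Q hQmin hgQ

/-- **Under (I0)₂, at a point `η = i x ∈ singImage`: `dim 𝒪_{Y,η} + dim closure {η} = j + 3`** (`dim 𝒪_{Y,η} =
dim 𝒪_{X,x} + 1` by the local equation, `coheight x + height x = dim X = j + 2`, closures of `x` and `i x` agree).
[folklore] -/
theorem ringKrullDim_stalk_add_height (h0 : S.InvDim₂) {x : S.X} (hη : S.i.base x ∈ singImage S.i.ker) :
    ringKrullDim (S.Y.presheaf.stalk (S.i.base x)) + (Order.height (S.i.base x) : WithBot ℕ∞) =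
      ((S.j + 3 : ℕ) : WithBot ℕ∞) := by
  haveI : IsLocallyNoetherian S.Y := LocallyOfFiniteType.isLocallyNoetherian S.f
  have hYreg : Scheme.IsRegular S.Y := Scheme.IsRegular.of_smooth S.f (Scheme.isRegular_Spec (.of k))
  haveI hreg : IsRegularLocalRing (S.Y.presheaf.stalk (S.i.base x)) := hYreg _
  -- `𝒪_{Y,η} ⧸ (ker i)_η ≅ 𝒪_{X,x}`
  have hker : stalkIdeal S.i.ker (S.i.base x) = RingHom.ker (S.i.stalkMap x).hom :=
    stalkIdeal_ker_eq_ker_stalkMap S.i x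
  have e : (S.Y.presheaf.stalk (S.i.base x) ⧸ stalkIdeal S.i.ker (S.i.base x)) ≃+*
      S.X.presheaf.stalk x :=
    (Ideal.quotEquivOfEq hker).trans
      (RingHom.quotientKerEquivOfSurjective (S.i.stalkMap_surjective x))
  haveI : IsIntegral S.i.ker.subscheme := Literature.AlgebraicGeometry.Motives.isIntegral_image_of_isIntegral S.i
  have hspan : stalkIdeal S.i.ker (S.i.base x) = Ideal.span {localGenerator S.i.ker (S.i.base x)} :=
    stalkIdeal_eq_span_localGenerator S.i.ker (S.i.base x)
      (S.isLocallyPrincipal (S.i.base x)).isPrincipal_stalkIdeal.principal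
  have hprime : Prime (localGenerator S.i.ker (S.i.base x)) :=
    prime_localGenerator_of_mem_singImage S.i.ker S.isLocallyPrincipal hη
  haveI := isDomain_of_isRegularLocalRing (S.Y.presheaf.stalk (S.i.base x))
  have hreg' : localGenerator S.i.ker (S.i.base x) ∈ nonZeroDivisors (S.Y.presheaf.stalk (S.i.base x)) :=
    mem_nonZeroDivisors_of_ne_zero hprime.ne_zero
  have hmax : localGenerator S.i.ker (S.i.base x) ∈ maximalIdeal (S.Y.presheaf.stalk (S.i.base x)) := by
    have h := (mem_support_iff_stalkIdeal_le S.i.ker (S.i.base x)).mp (mem_support_of_mem_singImage S.i.ker hη)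
    rw [hspan] at h
    exact h (Ideal.mem_span_singleton_self _)
  have hkey := ringKrullDim_quotient_span_singleton_succ_eq_ringKrullDim_of_mem_nonZeroDivisors hreg' hmax
  rw [← hspan, ringKrullDim_eq_of_ringEquiv e, ringKrullDim_stalk_eq_coheight] at hkey
  -- `coheight x + height x = j + 2`, `height (i x) = height x`
  have hsum := Literature.AlgebraicGeometry.Dimension.coheight_add_height_eq_topologicalKrullDim (S.i ≫ S.f) x
  rw [h0] at hsum
  have h1 : Order.coheight x + Order.height x = ((S.j + 2 : ℕ) : ℕ∞) := by
    rw [← WithBot.coe_natCast, WithBot.coe_inj] at hsum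
    exact hsum
  rw [← hkey, Literature.AlgebraicGeometry.Motives.Scheme.height_base_eq_of_isClosedImmersion S.i x]
  have h2 : ((Order.coheight x : ℕ∞) : WithBot ℕ∞) + 1 + Order.height x = ((S.j + 3 : ℕ) : WithBot ℕ∞) := by
    have h3 : ((Order.coheight x + Order.height x : ℕ∞) : WithBot ℕ∞) = ((S.j + 2 : ℕ) : ℕ∞) := by rw [h1]
    calc ((Order.coheight x : ℕ∞) : WithBot ℕ∞) + 1 + Order.height x
        = ((Order.coheight x + Order.height x : ℕ∞) : WithBot ℕ∞) + 1 := by push_cast; ring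
      _ = (((S.j + 2 : ℕ) : ℕ∞) : WithBot ℕ∞) + 1 := by rw [h3]
      _ = ((S.j + 3 : ℕ) : WithBot ℕ∞) := by norm_cast
  exact h2

/-- **Under (I0)₂, `dim Γ(Y, W) ⧸ Q ≤ j + 3` for every prime `Q` below the prime of a point `η = i x ∈ singImage` of an
affine chart `W`** (Hartshorne I.1.8A in `Γ(Y, W) ⧸ Q`: `ht(𝔭/Q) + dim Γ/𝔭 = dim Γ/Q`, with `ht(𝔭/Q) ≤ ht 𝔭 =
dim 𝒪_{Y,η}` and `dim Γ/𝔭 = dim closure {η}`). [folklore] -/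
theorem ringKrullDim_quotient_le_of_le_primeIdealOf (h0 : S.InvDim₂) (W : S.Y.affineOpens) {x : S.X}
    (hη : S.i.base x ∈ singImage S.i.ker) (hηW : S.i.base x ∈ (W : S.Y.Opens)) {Q : Ideal Γ(S.Y, W)}
    [hQ : Q.IsPrime] (hQP : Q ≤ (W.2.primeIdealOf ⟨S.i.base x, hηW⟩).asIdeal) :
    ringKrullDim (Γ(S.Y, W) ⧸ Q) ≤ ((S.j + 3 : ℕ) : WithBot ℕ∞) := by
  haveI := S.isNoetherianRing_sections W
  letI := sectionsAlgebra S.kStr W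
  haveI := S.finiteType_sections W
  set P := (W.2.primeIdealOf ⟨S.i.base x, hηW⟩).asIdeal with hP
  haveI hPp : P.IsPrime := (W.2.primeIdealOf ⟨S.i.base x, hηW⟩).2
  -- Hartshorne I.1.8A in the affine domain `Γ ⧸ Q`
  haveI : Algebra.FiniteType k (Γ(S.Y, W) ⧸ Q) :=
    Algebra.FiniteType.of_surjective (Ideal.Quotient.mkₐ k Q) (Ideal.Quotient.mkₐ_surjective k Q)
  haveI hPQ : (P.map (Ideal.Quotient.mk Q)).IsPrime := Ideal.map_isPrime_of_surjective
    Ideal.Quotient.mk_surjective (by rwa [Ideal.mk_ker])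
  have hH := Literature.AlgebraicGeometry.Motives.Ideal.height_add_ringKrullDim_quotient k (Γ(S.Y, W) ⧸ Q)
    (P.map (Ideal.Quotient.mk Q))
  -- `dim (Γ/Q)/(P/Q) = dim Γ/P = dim closure {η}`
  have hquot : ringKrullDim ((Γ(S.Y, W) ⧸ Q) ⧸ P.map (Ideal.Quotient.mk Q)) = Order.height (S.i.base x) := by
    rw [ringKrullDim_eq_of_ringEquiv (DoubleQuot.quotQuotEquivQuotOfLE hQP),
      ← Literature.AlgebraicGeometry.Dimension.Scheme.height_eq_ringKrullDim_quotient_primeIdealOf S.f W.2 hηW]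
  -- `ht(P/Q) ≤ ht P = dim 𝒪_{Y,η}`
  have hht : ((P.map (Ideal.Quotient.mk Q)).height : WithBot ℕ∞) ≤
      ringKrullDim (S.Y.presheaf.stalk (S.i.base x)) := by
    letI := S.Y.presheaf.algebra_section_stalk (⟨S.i.base x, hηW⟩ : (W : S.Y.Opens))
    haveI : IsLocalization.AtPrime (S.Y.presheaf.stalk (S.i.base x)) P :=
      W.2.isLocalization_stalk ⟨S.i.base x, hηW⟩
    rw [IsLocalization.AtPrime.ringKrullDim_eq_height P (S.Y.presheaf.stalk (S.i.base x))]
    -- heights as order heights in the prime spectra; `comap mk` is strictly monotone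
    have hmono : Monotone (PrimeSpectrum.comap (Ideal.Quotient.mk Q)) := fun p q hpq => Ideal.comap_mono hpq
    have hf : StrictMono (PrimeSpectrum.comap (Ideal.Quotient.mk Q)) :=
      hmono.strictMono_of_injective (PrimeSpectrum.comap_injective_of_surjective _ Ideal.Quotient.mk_surjective)
    have hle := Order.height_le_height_apply_of_strictMono _ hf ⟨P.map (Ideal.Quotient.mk Q), hPQ⟩
    have hcomap : PrimeSpectrum.comap (Ideal.Quotient.mk Q) ⟨P.map (Ideal.Quotient.mk Q), hPQ⟩ = ⟨P, hPp⟩ := by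
      apply PrimeSpectrum.ext
      rw [PrimeSpectrum.comap_asIdeal, Ideal.comap_map_of_surjective _ Ideal.Quotient.mk_surjective,
        ← RingHom.ker_eq_comap_bot, Ideal.mk_ker, sup_eq_left.mpr hQP]
    rw [hcomap] at hle
    have e1 := PrimeSpectrum.height_eq_orderHeight (⟨P.map (Ideal.Quotient.mk Q), hPQ⟩ : PrimeSpectrum _)
    have e2 := PrimeSpectrum.height_eq_orderHeight (⟨P, hPp⟩ : PrimeSpectrum Γ(S.Y, W))
    change ((PrimeSpectrum.asIdeal ⟨P.map (Ideal.Quotient.mk Q), hPQ⟩).height : WithBot ℕ∞) ≤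
      (PrimeSpectrum.asIdeal ⟨P, hPp⟩).height
    rw [e1, e2]
    exact_mod_cast hle
  have hsum := S.ringKrullDim_stalk_add_height h0 hη
  rw [← hH, hquot]
  calc ((P.map (Ideal.Quotient.mk Q)).height : WithBot ℕ∞) + (Order.height (S.i.base x) : WithBot ℕ∞)
      ≤ ringKrullDim (S.Y.presheaf.stalk (S.i.base x)) + (Order.height (S.i.base x) : WithBot ℕ∞) :=
        add_le_add hht le_rfl
    _ = ((S.j + 3 : ℕ) : WithBot ℕ∞) := hsum

end Summit.ResolutionOfSingularities.ResolutionOfSingularities.Theorems.ELadderOne.Stage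

end
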